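import Mathlib

/-!
# `MatrixDescartes` census — rank-one `(2,4)₁`, lone letter: the FOUR-LETTER CRAMER FRAME (free pair = the two letters on the other side),
# signs of the five minors on the window, and «at most one scale per direction» on each of the two branches

HONEST FRAMING.  Object-search cell `pub-symmetroid`, seat `val-sym-mdr-p1` (generation 22); helper file `--supports` the crux item
stmt-ValiantsHypothesis-18050 (`Theses.LacunarySymmetroid.MatrixDescartes`, OPEN, on HOLD) with NO closure claim.  First kernel piece of the `K = 4`
lone-letter programme laid out in the seat memo LONE-LETTER.md §8b–§8d (located there; nothing of it is claimed here beyond what is proved below).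
Companion of `…PivotRankOneCriticalWindows` (windows law), `…CriticalWindowsThree*` (the `K = 3` lone-letter law).  Nothing here bears on `MatrixDescartes`
in its window, on `DoorA26` / `DoorA34`, registers / credences, or `VP ≠ VNP`; no count is proved.

SETTING.  Pivot letter `0` at `t₀` (rate `−a < 0`), letters `i, k` at `tᵢ, tₖ < t₀` (rates `bᵢ, bₖ > 0`), the LONE letter `j` at `tⱼ > t₀` (rate `bⱼ > 0`);
point weights `Wₘ = wₘ x^{dₘ}`; direction `T`; critical equations `∑ Wₘ Aₘ = 0`, `∑ Wₘ Bₘ = 0` with `Aₘ = T² − tₘ²`, `Bₘ = βₘ (T − tₘ)²`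
(`…CriticalWindows`); minors `M_{mn} := AₘBₙ − AₙBₘ`.
* §1 `weights_cramer_four` — Cramer with the two LEFT letters as the free pair: `W₀·M_{0j} = Wᵢ·M_{ji} + Wₖ·M_{jk}` and `Wⱼ·M_{0j} = Wᵢ·M_{i0} + Wₖ·M_{k0}`
  (`linear_combination`). [folklore]
* §2 `minor_factor` — `M_{mn} = (T−tₘ)(T−tₙ)·[(T+tₘ)βₙ(T−tₙ) − (T+tₙ)βₘ(T−tₘ)]` (the quadratic brackets of the `K = 3` files, one per pair). [folklore]
* §3 `minor_signs_right` — on the right window (`t₀ < T < tⱼ` and the window inequality `bⱼ(T+t₀)(tⱼ−T) < a(T−t₀)(tⱼ+T)` of the windows law) ALL FIVE minors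
  `M_{0j}, M_{ji}, M_{jk}, M_{i0}, M_{k0}` are NEGATIVE; so both Cramer identities have positive coefficients after a sign flip, with no pole on the window
  (the memo's `a₁, b₁, a₂, b₂ > 0`). [folklore]
* §4 `scale_unique_of_branch0`, `scale_unique_of_branchj` — «AT MOST ONE SCALE PER DIRECTION»: for fixed `T`, the first identity
  `w₀x^{d₀}|M_{0j}| = wᵢx^{dᵢ}|M_{ji}| + wₖx^{dₖ}|M_{jk}|` has at most one solution `x > 0` whenever `d₀ < dᵢ, d₀ < dₖ` (always: decreasing against
  increasing after division by `x^{d₀}`), and the second `wⱼx^{dⱼ}|M_{0j}| = wᵢx^{dᵢ}|M_{i0}| + wₖx^{dₖ}|M_{k0}|` has at most one whenever the lone letter is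
  the FASTEST (`dᵢ, dₖ < dⱼ`).  Consequently (`critical_scale_unique`) two critical points of the four-letter window profile with the SAME direction on the
  lone letter's side coincide — the critical set there is a graph over the direction (the two branches `ρ₀(T)`, `ρⱼ(T)` of the memo are single-valued).
* §5 (appendix) `minor_cofactor_identities`, `critical_iff_cramer_four` — the Cramer pair is EQUIVALENT to the two critical equations when `M_{0j} ≠ 0`.
[folklore] Cramer's rule, sign bookkeeping, strict monotonicity of natural powers.  No definitions, no named facts.
-/

-- `Summit.ValiantsHypothesis.ValiantsHypothesis.…` repeats a component by the D-0017 layout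
-- (single-conjunct summit), which the `dupNamespace` linter flags; the name is mandated.
set_option linter.dupNamespace false

namespace Summit.ValiantsHypothesis.ValiantsHypothesis.Theorems.LacunarySymmetroidMatrixDescartes.Pivot.CriticalWindows.Four

/-! ## 1. Cramer with the two left letters as the free pair -/

/-- **FOUR-LETTER CRAMER.**  From `∑ WₘAₘ = 0` and `∑ WₘBₘ = 0` (letters `0, i, k, j`):
`W₀(A₀Bⱼ − AⱼB₀) = Wᵢ(AⱼBᵢ − AᵢBⱼ) + Wₖ(AⱼBₖ − AₖBⱼ)` and `Wⱼ(A₀Bⱼ − AⱼB₀) = Wᵢ(AᵢB₀ − A₀Bᵢ) + Wₖ(AₖB₀ − A₀Bₖ)`. [folklore] -/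
theorem weights_cramer_four (A₀ Ai Ak Aj B₀ Bi Bk Bj W₀ Wi Wk Wj : ℝ)
    (h1 : W₀ * A₀ + Wi * Ai + Wk * Ak + Wj * Aj = 0) (h2 : W₀ * B₀ + Wi * Bi + Wk * Bk + Wj * Bj = 0) :
    W₀ * (A₀ * Bj - Aj * B₀) = Wi * (Aj * Bi - Ai * Bj) + Wk * (Aj * Bk - Ak * Bj) ∧
      Wj * (A₀ * Bj - Aj * B₀) = Wi * (Ai * B₀ - A₀ * Bi) + Wk * (Ak * B₀ - A₀ * Bk) := by
  constructor
  · linear_combination Bj * h1 - Aj * h2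
  · linear_combination A₀ * h2 - B₀ * h1

/-! ## 2. The minors factor through the quadratic brackets -/

/-- **MINOR FACTORISATION.**  `(T²−tₘ²)·βₙ(T−tₙ)² − (T²−tₙ²)·βₘ(T−tₘ)² = (T−tₘ)(T−tₙ)·[(T+tₘ)βₙ(T−tₙ) − (T+tₙ)βₘ(T−tₘ)]`. [folklore] -/
theorem minor_factor (βm βn tm tn T : ℝ) :
    (T ^ 2 - tm ^ 2) * (βn * (T - tn) ^ 2) - (T ^ 2 - tn ^ 2) * (βm * (T - tm) ^ 2)
      = (T - tm) * (T - tn) * ((T + tm) * βn * (T - tn) - (T + tn) * βm * (T - tm)) := by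
  ring

/-! ## 3. Signs of the five minors on the right window -/

/-- **THE FIVE MINORS ARE NEGATIVE ON THE RIGHT WINDOW.**  For `0 < tᵢ, tₖ < t₀ < T < tⱼ`, positive rates, and the window inequality
`bⱼ(T+t₀)(tⱼ−T) < a(T−t₀)(tⱼ+T)`: `M_{0j} < 0`, `M_{ji} < 0`, `M_{jk} < 0`, `M_{i0} < 0`, `M_{k0} < 0`. [folklore] -/
theorem minor_signs_right {a bi bk bj t₀ ti tk tj T : ℝ} (ha : 0 < a) (hbi : 0 < bi) (hbk : 0 < bk) (hbj : 0 < bj)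
    (hti : 0 < ti) (htk : 0 < tk) (hi0 : ti < t₀) (hk0 : tk < t₀) (h0T : t₀ < T) (hTj : T < tj)
    (hwin : bj * (T + t₀) * (tj - T) < a * (T - t₀) * (tj + T)) :
    (T ^ 2 - t₀ ^ 2) * (bj * (T - tj) ^ 2) - (T ^ 2 - tj ^ 2) * (-a * (T - t₀) ^ 2) < 0 ∧
    (T ^ 2 - tj ^ 2) * (bi * (T - ti) ^ 2) - (T ^ 2 - ti ^ 2) * (bj * (T - tj) ^ 2) < 0 ∧
    (T ^ 2 - tj ^ 2) * (bk * (T - tk) ^ 2) - (T ^ 2 - tk ^ 2) * (bj * (T - tj) ^ 2) < 0 ∧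
    (T ^ 2 - ti ^ 2) * (-a * (T - t₀) ^ 2) - (T ^ 2 - t₀ ^ 2) * (bi * (T - ti) ^ 2) < 0 ∧
    (T ^ 2 - tk ^ 2) * (-a * (T - t₀) ^ 2) - (T ^ 2 - t₀ ^ 2) * (bk * (T - tk) ^ 2) < 0 := by
  have l0 : 0 < T - t₀ := by linarith
  have li : 0 < T - ti := by linarith
  have lk : 0 < T - tk := by linarith
  have lj : T - tj < 0 := by linarith
  refine ⟨?_, ?_, ?_, ?_, ?_⟩
  · rw [minor_factor]
    have hb : 0 < (T + t₀) * bj * (T - tj) - (T + tj) * (-a) * (T - t₀) := by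
      have e : (T + t₀) * bj * (T - tj) - (T + tj) * (-a) * (T - t₀)
          = a * (T - t₀) * (tj + T) - bj * (T + t₀) * (tj - T) := by ring
      rw [e]; linarith
    exact mul_neg_of_neg_of_pos (mul_neg_of_pos_of_neg l0 lj) hb
  · rw [minor_factor]
    have hb : 0 < (T + tj) * bi * (T - ti) - (T + ti) * bj * (T - tj) := by
      have : 0 < (T + tj) * bi * (T - ti) := mul_pos (mul_pos (by linarith) hbi) li
      have : (T + ti) * bj * (T - tj) < 0 := mul_neg_of_pos_of_neg (mul_pos (by linarith) hbj) lj
      linarith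
    exact mul_neg_of_neg_of_pos (mul_neg_of_neg_of_pos lj li) hb
  · rw [minor_factor]
    have hb : 0 < (T + tj) * bk * (T - tk) - (T + tk) * bj * (T - tj) := by
      have : 0 < (T + tj) * bk * (T - tk) := mul_pos (mul_pos (by linarith) hbk) lk
      have : (T + tk) * bj * (T - tj) < 0 := mul_neg_of_pos_of_neg (mul_pos (by linarith) hbj) lj
      linarith
    exact mul_neg_of_neg_of_pos (mul_neg_of_neg_of_pos lj lk) hb
  · rw [minor_factor]
    have hb : (T + ti) * (-a) * (T - t₀) - (T + t₀) * bi * (T - ti) < 0 := by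
      have : (T + ti) * (-a) * (T - t₀) < 0 := mul_neg_of_neg_of_pos (mul_neg_of_pos_of_neg (by linarith) (by linarith)) l0
      have : 0 < (T + t₀) * bi * (T - ti) := mul_pos (mul_pos (by linarith) hbi) li
      linarith
    exact mul_neg_of_pos_of_neg (mul_pos li l0) hb
  · rw [minor_factor]
    have hb : (T + tk) * (-a) * (T - t₀) - (T + t₀) * bk * (T - tk) < 0 := by
      have : (T + tk) * (-a) * (T - t₀) < 0 := mul_neg_of_neg_of_pos (mul_neg_of_pos_of_neg (by linarith) (by linarith)) l0
      have : 0 < (T + t₀) * bk * (T - tk) := mul_pos (mul_pos (by linarith) hbk) lk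
      linarith
    exact mul_neg_of_pos_of_neg (mul_pos lk l0) hb

/-! ## 4. At most one scale per direction on each branch -/

/-- **BRANCH `0` IS SINGLE-VALUED.**  For `d₀ < dᵢ`, `d₀ < dₖ` and positive `p, q, r`, the equation `p·x^{d₀} = q·x^{dᵢ} + r·x^{dₖ}` has at most one
positive solution (after division by `x^{d₀}`: a constant against a strictly increasing function). [folklore] -/
theorem scale_unique_of_branch0 {p q r x y : ℝ} {d₀ di dk : ℕ} (hq : 0 < q) (hr : 0 < r) (h0i : d₀ < di) (h0k : d₀ < dk)
    (hx : 0 < x) (hy : 0 < y)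
    (ex : p * x ^ d₀ = q * x ^ di + r * x ^ dk) (ey : p * y ^ d₀ = q * y ^ di + r * y ^ dk) : x = y := by
  obtain ⟨m, rfl⟩ := Nat.exists_eq_add_of_lt h0i
  obtain ⟨n, rfl⟩ := Nat.exists_eq_add_of_lt h0k
  -- divide by `x^{d₀}`
  have ex' : p = q * x ^ (m + 1) + r * x ^ (n + 1) := by
    have hx0 : x ^ d₀ ≠ 0 := pow_ne_zero _ hx.ne'
    have e : p * x ^ d₀ = (q * x ^ (m + 1) + r * x ^ (n + 1)) * x ^ d₀ := by rw [ex]; ring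
    exact mul_right_cancel₀ hx0 e
  have ey' : p = q * y ^ (m + 1) + r * y ^ (n + 1) := by
    have hy0 : y ^ d₀ ≠ 0 := pow_ne_zero _ hy.ne'
    have e : p * y ^ d₀ = (q * y ^ (m + 1) + r * y ^ (n + 1)) * y ^ d₀ := by rw [ey]; ring
    exact mul_right_cancel₀ hy0 e
  by_contra hne
  rcases lt_or_gt_of_ne hne with h | h
  · have h1 : x ^ (m + 1) < y ^ (m + 1) := pow_lt_pow_left₀ h hx.le (Nat.succ_ne_zero m)
    have h2 : x ^ (n + 1) < y ^ (n + 1) := pow_lt_pow_left₀ h hx.le (Nat.succ_ne_zero n)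
    nlinarith
  · have h1 : y ^ (m + 1) < x ^ (m + 1) := pow_lt_pow_left₀ h hy.le (Nat.succ_ne_zero m)
    have h2 : y ^ (n + 1) < x ^ (n + 1) := pow_lt_pow_left₀ h hy.le (Nat.succ_ne_zero n)
    nlinarith

/-- **BRANCH `j` IS SINGLE-VALUED WHEN THE LONE LETTER IS FASTEST.**  For `dᵢ < dⱼ`, `dₖ < dⱼ` and positive `c, α, β`, the equation
`c·x^{dⱼ} = α·x^{dᵢ} + β·x^{dₖ}` has at most one positive solution (any real `c`). [folklore] -/
theorem scale_unique_of_branchj {c α β x y : ℝ} {di dk dj : ℕ} (hα : 0 < α) (hβ : 0 < β) (hij : di < dj) (hkj : dk < dj)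
    (hx : 0 < x) (hy : 0 < y)
    (ex : c * x ^ dj = α * x ^ di + β * x ^ dk) (ey : c * y ^ dj = α * y ^ di + β * y ^ dk) : x = y := by
  -- wlog `dᵢ ≤ dₖ` is not needed: treat `x < y` and `y < x` symmetrically via the normalised identity
  by_contra hne
  -- key: `c x^{dⱼ} − α x^{dᵢ} − β x^{dₖ} = 0`; compare `x` and `y` after multiplying crosswise
  have key : ∀ u v : ℝ, 0 < u → u < v → c * u ^ dj = α * u ^ di + β * u ^ dk → c * v ^ dj = α * v ^ di + β * v ^ dk → False := by
    intro u v hu huv eu ev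
    obtain ⟨m, rfl⟩ := Nat.exists_eq_add_of_lt hij
    obtain ⟨n, hn⟩ := Nat.exists_eq_add_of_lt hkj
    -- from `eu`: `c u^{dⱼ} > β u^{dₖ}` hence `c u^{m+1} ... `; use the ratio form: `c = α u^{-(m+1)} + β u^{dk - dj}` decreasing in `u`
    -- concretely: α u^{di} = u^{di} (c u^{m+1} - β u^{dk} / …) — we avoid division: multiply `eu` by `v^{dj}` and `ev` by `u^{dj}`
    have hv : 0 < v := lt_trans hu huv
    -- α u^{di} v^{dj} + β u^{dk} v^{dj} = c u^{dj} v^{dj} = α v^{di} u^{dj} + β v^{dk} u^{dj}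
    have e : α * (u ^ di * v ^ (di + m + 1)) + β * (u ^ dk * v ^ (di + m + 1))
        = α * (v ^ di * u ^ (di + m + 1)) + β * (v ^ dk * u ^ (di + m + 1)) := by
      have e1 : c * u ^ (di + m + 1) * v ^ (di + m + 1) = (α * u ^ di + β * u ^ dk) * v ^ (di + m + 1) := by rw [eu]
      have e2 : c * v ^ (di + m + 1) * u ^ (di + m + 1) = (α * v ^ di + β * v ^ dk) * u ^ (di + m + 1) := by rw [ev]
      nlinarith [e1, e2]
    -- but `u^{di} v^{dj} > v^{di} u^{dj}` (i.e. `v^{m+1} > u^{m+1}`) and `u^{dk} v^{dj} > v^{dk} u^{dj}` (i.e. `v^{dj-dk} > u^{dj-dk}`)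
    have p1 : v ^ di * u ^ (di + m + 1) < u ^ di * v ^ (di + m + 1) := by
      have : u ^ (m + 1) < v ^ (m + 1) := pow_lt_pow_left₀ huv hu.le (Nat.succ_ne_zero m)
      have hud : 0 < u ^ di := pow_pos hu _
      have hvd : 0 < v ^ di := pow_pos hv _
      have e3 : v ^ di * u ^ (di + m + 1) = (u ^ di * v ^ di) * u ^ (m + 1) := by ring
      have e4 : u ^ di * v ^ (di + m + 1) = (u ^ di * v ^ di) * v ^ (m + 1) := by ring
      rw [e3, e4]
      exact mul_lt_mul_of_pos_left this (mul_pos hud hvd)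
    have p2 : v ^ dk * u ^ (di + m + 1) < u ^ dk * v ^ (di + m + 1) := by
      have hdj : di + m + 1 = dk + n + 1 := by omega
      rw [hdj]
      have : u ^ (n + 1) < v ^ (n + 1) := pow_lt_pow_left₀ huv hu.le (Nat.succ_ne_zero n)
      have hud : 0 < u ^ dk := pow_pos hu _
      have hvd : 0 < v ^ dk := pow_pos hv _
      have e3 : v ^ dk * u ^ (dk + n + 1) = (u ^ dk * v ^ dk) * u ^ (n + 1) := by ring
      have e4 : u ^ dk * v ^ (dk + n + 1) = (u ^ dk * v ^ dk) * v ^ (n + 1) := by ring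
      rw [e3, e4]
      exact mul_lt_mul_of_pos_left this (mul_pos hud hvd)
    have : α * (v ^ di * u ^ (di + m + 1)) + β * (v ^ dk * u ^ (di + m + 1))
        < α * (u ^ di * v ^ (di + m + 1)) + β * (u ^ dk * v ^ (di + m + 1)) := by
      have := mul_lt_mul_of_pos_left p1 hα
      have := mul_lt_mul_of_pos_left p2 hβ
      linarith
    linarith
  rcases lt_or_gt_of_ne hne with h | h
  · exact key x y hx h ex ey
  · exact key y x hy h ey ex

/-- **AT MOST ONE SCALE PER DIRECTION (lone letter's side).**  If `(x, T)` and `(y, T)` are both critical points of the four-letter window profile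
(`Wₘ = wₘ x^{dₘ}` resp. `wₘ y^{dₘ}`; same direction `T` on the right window) then `x = y` — using only `d₀ < dᵢ, dₖ` (branch `0`); the critical set on the
lone letter's side is a graph over the direction. [folklore] -/
theorem critical_scale_unique {a bi bk bj t₀ ti tk tj T w₀ wi wk wj x y : ℝ} {d₀ di dk dj : ℕ}
    (ha : 0 < a) (hbi : 0 < bi) (hbk : 0 < bk) (hbj : 0 < bj) (hti : 0 < ti) (htk : 0 < tk) (hi0 : ti < t₀) (hk0 : tk < t₀)
    (h0T : t₀ < T) (hTj : T < tj) (hwin : bj * (T + t₀) * (tj - T) < a * (T - t₀) * (tj + T))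
    (hwi : 0 < wi) (hwk : 0 < wk) (h0i : d₀ < di) (h0k : d₀ < dk) (hx : 0 < x) (hy : 0 < y)
    (hx1 : w₀ * x ^ d₀ * (T ^ 2 - t₀ ^ 2) + wi * x ^ di * (T ^ 2 - ti ^ 2) + wk * x ^ dk * (T ^ 2 - tk ^ 2)
        + wj * x ^ dj * (T ^ 2 - tj ^ 2) = 0)
    (hx2 : w₀ * x ^ d₀ * (-a * (T - t₀) ^ 2) + wi * x ^ di * (bi * (T - ti) ^ 2) + wk * x ^ dk * (bk * (T - tk) ^ 2)
        + wj * x ^ dj * (bj * (T - tj) ^ 2) = 0)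
    (hy1 : w₀ * y ^ d₀ * (T ^ 2 - t₀ ^ 2) + wi * y ^ di * (T ^ 2 - ti ^ 2) + wk * y ^ dk * (T ^ 2 - tk ^ 2)
        + wj * y ^ dj * (T ^ 2 - tj ^ 2) = 0)
    (hy2 : w₀ * y ^ d₀ * (-a * (T - t₀) ^ 2) + wi * y ^ di * (bi * (T - ti) ^ 2) + wk * y ^ dk * (bk * (T - tk) ^ 2)
        + wj * y ^ dj * (bj * (T - tj) ^ 2) = 0) : x = y := by
  obtain ⟨m0j, mji, mjk, -, -⟩ := minor_signs_right ha hbi hbk hbj hti htk hi0 hk0 h0T hTj hwin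
  obtain ⟨cx, -⟩ := weights_cramer_four (T ^ 2 - t₀ ^ 2) (T ^ 2 - ti ^ 2) (T ^ 2 - tk ^ 2) (T ^ 2 - tj ^ 2)
    (-a * (T - t₀) ^ 2) (bi * (T - ti) ^ 2) (bk * (T - tk) ^ 2) (bj * (T - tj) ^ 2)
    (w₀ * x ^ d₀) (wi * x ^ di) (wk * x ^ dk) (wj * x ^ dj) hx1 hx2
  obtain ⟨cy, -⟩ := weights_cramer_four (T ^ 2 - t₀ ^ 2) (T ^ 2 - ti ^ 2) (T ^ 2 - tk ^ 2) (T ^ 2 - tj ^ 2)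
    (-a * (T - t₀) ^ 2) (bi * (T - ti) ^ 2) (bk * (T - tk) ^ 2) (bj * (T - tj) ^ 2)
    (w₀ * y ^ d₀) (wi * y ^ di) (wk * y ^ dk) (wj * y ^ dj) hy1 hy2
  -- the three minors `M_{0j}, M_{ji}, M_{jk}` are negative: flip signs to get positive coefficients
  set P := -((T ^ 2 - t₀ ^ 2) * (bj * (T - tj) ^ 2) - (T ^ 2 - tj ^ 2) * (-a * (T - t₀) ^ 2)) with hP
  set Q := -((T ^ 2 - tj ^ 2) * (bi * (T - ti) ^ 2) - (T ^ 2 - ti ^ 2) * (bj * (T - tj) ^ 2)) with hQ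
  set R := -((T ^ 2 - tj ^ 2) * (bk * (T - tk) ^ 2) - (T ^ 2 - tk ^ 2) * (bj * (T - tj) ^ 2)) with hR
  have hPp : 0 < P := by rw [hP]; linarith
  have hQp : 0 < Q := by rw [hQ]; linarith
  have hRp : 0 < R := by rw [hR]; linarith
  have ex : (w₀ * P) * x ^ d₀ = (wi * Q) * x ^ di + (wk * R) * x ^ dk := by
    rw [hP, hQ, hR]; linear_combination (-1 : ℝ) * cx
  have ey : (w₀ * P) * y ^ d₀ = (wi * Q) * y ^ di + (wk * R) * y ^ dk := by
    rw [hP, hQ, hR]; linear_combination (-1 : ℝ) * cy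
  exact scale_unique_of_branch0 (mul_pos hwi hQp) (mul_pos hwk hRp) h0i h0k hx hy ex ey

/-! ## 5. (Appendix, generation 22) The Cramer pair is EQUIVALENT to criticality -/

/-- **PLÜCKER / COFACTOR IDENTITIES.**  For the minors `M_{mn} = AₘBₙ − AₙBₘ` of four columns:
`M_{ji}·A₀ + M_{0j}·Aᵢ + M_{i0}·Aⱼ = 0` and `M_{jk}·A₀ + M_{0j}·Aₖ + M_{k0}·Aⱼ = 0` (expansion of a determinant with two equal rows), and the same
with `B` in place of `A`. [folklore] -/
theorem minor_cofactor_identities (A₀ Ai Ak Aj B₀ Bi Bk Bj : ℝ) :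
    (Aj * Bi - Ai * Bj) * A₀ + (A₀ * Bj - Aj * B₀) * Ai + (Ai * B₀ - A₀ * Bi) * Aj = 0 ∧
    (Aj * Bk - Ak * Bj) * A₀ + (A₀ * Bj - Aj * B₀) * Ak + (Ak * B₀ - A₀ * Bk) * Aj = 0 ∧
    (Aj * Bi - Ai * Bj) * B₀ + (A₀ * Bj - Aj * B₀) * Bi + (Ai * B₀ - A₀ * Bi) * Bj = 0 ∧
    (Aj * Bk - Ak * Bj) * B₀ + (A₀ * Bj - Aj * B₀) * Bk + (Ak * B₀ - A₀ * Bk) * Bj = 0 := by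
  refine ⟨by ring, by ring, by ring, by ring⟩

/-- **THE CRAMER PAIR IS EQUIVALENT TO THE TWO CRITICAL EQUATIONS** whenever `M_{0j} = A₀Bⱼ − AⱼB₀ ≠ 0` (on the right window it is `< 0`,
`minor_signs_right`): `(∑ WₘAₘ = 0 ∧ ∑ WₘBₘ = 0) ↔ (W₀M_{0j} = WᵢM_{ji} + WₖM_{jk} ∧ WⱼM_{0j} = WᵢM_{i0} + WₖM_{k0})`.  So the critical set of the
four-letter window profile on the lone letter's side is EXACTLY the intersection of the two branches of memo LONE-LETTER §8b. [folklore] -/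
theorem critical_iff_cramer_four {A₀ Ai Ak Aj B₀ Bi Bk Bj W₀ Wi Wk Wj : ℝ} (hM : A₀ * Bj - Aj * B₀ ≠ 0) :
    (W₀ * A₀ + Wi * Ai + Wk * Ak + Wj * Aj = 0 ∧ W₀ * B₀ + Wi * Bi + Wk * Bk + Wj * Bj = 0) ↔
    (W₀ * (A₀ * Bj - Aj * B₀) = Wi * (Aj * Bi - Ai * Bj) + Wk * (Aj * Bk - Ak * Bj) ∧
      Wj * (A₀ * Bj - Aj * B₀) = Wi * (Ai * B₀ - A₀ * Bi) + Wk * (Ak * B₀ - A₀ * Bk)) := by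
  constructor
  · rintro ⟨h1, h2⟩
    exact weights_cramer_four A₀ Ai Ak Aj B₀ Bi Bk Bj W₀ Wi Wk Wj h1 h2
  · rintro ⟨c1, c2⟩
    obtain ⟨pa1, pa2, pb1, pb2⟩ := minor_cofactor_identities A₀ Ai Ak Aj B₀ Bi Bk Bj
    constructor
    · have e : (W₀ * A₀ + Wi * Ai + Wk * Ak + Wj * Aj) * (A₀ * Bj - Aj * B₀) = 0 := by
        linear_combination A₀ * c1 + Aj * c2 - Wi * pa1 - Wk * pa2
      rcases mul_eq_zero.mp e with h | h
      · exact h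
      · exact absurd h hM
    · have e : (W₀ * B₀ + Wi * Bi + Wk * Bk + Wj * Bj) * (A₀ * Bj - Aj * B₀) = 0 := by
        linear_combination B₀ * c1 + Bj * c2 - Wi * pb1 - Wk * pb2
      rcases mul_eq_zero.mp e with h | h
      · exact h
      · exact absurd h hM

end Summit.ValiantsHypothesis.ValiantsHypothesis.Theorems.LacunarySymmetroidMatrixDescartes.Pivot.CriticalWindows.Four
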